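import Summits.BirchSwinnertonDyer.Rank1Residual.GaloisImage.KatoDepletedLValue
import Literature.NumberTheory.EllipticCurves.ModularSymbolsHeckeProofs
import Literature.NumberTheory.EllipticCurves.NewformGaloisRepIntegralityProofs
import Literature.NumberTheory.EllipticCurves.CuspFormTwist
import Literature.NumberTheory.EllipticCurves.ImaginaryPeriod
import Literature.NumberTheory.EllipticCurves.ComplexMultiplicationBurungaleFlachProofs
import HarnessLib

/-!
# F″ programme, the VALUE EXIT: Néron `p`-integrality of the DEPLETED twisted critical value ⟹ F″'s
# conclusion `∃ s, p ∤ s, s·ϖ·r ∈ ℤ̄` (Birch's formula + Euler-factor depletion at `s = 1`; P1-shape-tolerant)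
# (`--supports stmt-BirchSwinnertonDyer-22226`, helper; route EdixhovenFibreFiveSeven)

HONEST FRAMING. Route `EdixhovenFibreFiveSeven`, crux K★ `StarredOptimalManinUnitFiveSeven`
(stmt-BirchSwinnertonDyer-22226), line `kato-lever`: K★ ⟸ F″ (p581141), F″ =
`Literature.NumberTheory.EllipticCurves.kato_neron_isIntegral_twistedSymbolSum_of_additive_five_le` (cite-only).
The F″ programme map (`Cruxes/StarredOptimalManinUnitFiveSeven/Lines/kato-lever-F2-programme.md` §4) reduces F″ to
P1 (cite-only: Kato's zeta values in a NÉRON coordinate — a value law `Σ_b χ(b)σ_b(x) = T·u·n_ξ·L_S(f,χ,1)/Ω^±(V)`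
with `S = prime(m p N)`) ⊕ the receptacle (P2, P3: every `Λ_v z` is `v`-integral) ⊕ the semi-local descent (P4:
then `Σ_b χ(b)σ_b(x)` is `p`-integral) ⊕ transport (P6). After dividing the `p`-units `T, u, n_ξ` these deliver the
**Néron `p`-integrality of the depleted critical value**: `∃ s, p ∤ s, s·L_{pN}(f, χ̄, 1)/Ω⁺(V) ∈ ℤ̄` (even `χ`),
resp. `s·L_{pN}(f, χ̄, 1)/(i·Ω⁻(V)) ∈ ℤ̄` (odd `χ`). THIS FILE proves the last, P1-SHAPE-INDEPENDENT step: that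
statement ⟹ the conclusion clause of F″ for its own binders `(ϖ, r)` (`ϖ·Ω^±(V) = Ω^±_f`,
`∏_{ℓ∥N}(ℓ − a_ℓχ(ℓ))(ℓ − a_ℓχ̄(ℓ))·Σ_aχ(a){∞, a/m}_f = r·Ω^±_f(·i)` ⟹ `∃ s, p ∤ s, s·ϖ·r ∈ ℤ̄`). Mechanism, all
tree theorems: Birch's formula `τ(χ)·L(f, χ̄, 1) = Σ_aχ(a){∞, a/m}_f` (`ModularForms.twisted_LValue_eq_holds`), the
depletion identity at `s = 1` (`…GaloisImage.DepletedLValue.depletedTwistedL_one_eq`: `L_{pN}(f,χ̄,1) =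
∏_{ℓ∣N}(1 − χ̄(ℓ)a_ℓ/ℓ)·L(f,χ̄,1)`, the factors at `ℓ² ∣ N` — among them `ℓ = p`, additive — being `1` as `a_ℓ = 0`),
and `∏_{ℓ∥N}(ℓ − a_ℓχ̄(ℓ)) = ∏ℓ · ∏(1 − a_ℓχ̄(ℓ)/ℓ)`, whence the identity
**`ϖ·r = [∏_{ℓ∥N} ℓ·(ℓ − a_ℓχ(ℓ))] · τ(χ) · L_{pN}(f, χ̄, 1)/Ω^±(V)`** with an ALGEBRAIC-INTEGER bracket
(`a_ℓ ∈ ℤ`, `χ(ℓ)` and `τ(χ) = Σχ(a)ζ^a` integral). TOOL theorems only (no definition, no named fact, no `sorry`);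
closes nothing by itself; BSD is not proved by any of this.

## Contents (`f ∈ S₂(Γ₀(N))` with `IsNewformOf V f`, `p ∣ N`, `a_ℓ(V) = 0` at `ℓ² ∣ N`, `m` coprime to `pN`, `χ` primitive mod `m`)

* §1 integrality helpers: `isIntegral_stdAddChar`, `isIntegral_gaussSum` (Gauss sums are algebraic integers).
* §2 `primeFactors_filter_not_dvd_eq` (the depletion index set is `N.primeFactors`),
  `depleted_one_eq_prod_mul` (`L_{pN}(f,χ̄,1) = ∏_{ℓ∥N}(1 − χ̄(ℓ)a_ℓ ℓ⁻¹)·L(f,χ̄,1)`),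
  `prod_euler_eq` (`∏_{ℓ∥N}(ℓ − a_ℓχ(ℓ))(ℓ − a_ℓχ(ℓ)⁻¹) = [∏(ℓ − a_ℓχ(ℓ))]·[∏ℓ]·∏(1 − χ̄(ℓ)a_ℓℓ⁻¹)`).
* §3 ★ `katoNeron_even_of_depletedValue` / ★ `katoNeron_odd_of_depletedValue` — the two parity clauses of F″'s
  conclusion from the Néron `p`-integrality of the `(m·pN)`-depleted value of `χ̄`
  (`Kato2004.EulerSystemValues.IsDepletedTwistedL f m (p * N) χ⁻¹ L`).

References: B. J. Birch (1971); B. Mazur, J. Tate, J. Teitelbaum (1986), §I.8 (8.6) [MazurTateTeitelbaum1986];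
K. Kato, Astérisque 295 (2004), §6.2 (p. 161), Thm. 6.6 (1) (p. 163) [Kato2004Asterisque]; programme map
`…/kato-lever-F2-programme.md` §1, §4.
-/

set_option autoImplicit false
-- the Theorems namespace of a single-conjunct summit repeats the summit name by design (D-0017)
set_option linter.dupNamespace false

noncomputable section

open scoped BigOperators
open Complex CongruenceSubgroup
open Literature.NumberTheory.EllipticCurves Literature.NumberTheory.EllipticCurves.ModularForms
open Literature.NumberTheory.EllipticCurves.Kato2004
open Summit.BirchSwinnertonDyer.Rank1Residual.GaloisImage.DepletedLValue

namespace Summit.BirchSwinnertonDyer.BirchSwinnertonDyer.Theorems.StarredOptimalManinUnitFiveSevenValueExit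

/-! ## §1 Integrality helpers -/

/-- The values of the standard additive character of `ℤ/m` are algebraic integers (`m`-th roots of unity).
[folklore] -/
theorem isIntegral_stdAddChar {m : ℕ} [NeZero m] (a : ZMod m) :
    IsIntegral ℤ (ZMod.stdAddChar (N := m) a) := by
  refine IsIntegral.of_pow (NeZero.pos m) ?_
  have h : (ZMod.stdAddChar (N := m) a) ^ m = 1 := by
    rw [← AddChar.map_nsmul_eq_pow, nsmul_eq_mul, ZMod.natCast_self, zero_mul, AddChar.map_zero_eq_one]
  rw [h]
  exact isIntegral_one

/-- **Gauss sums are algebraic integers**: `τ(χ) = Σ_a χ(a)ζ^a`. [folklore] -/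
theorem isIntegral_gaussSum {m : ℕ} [NeZero m] (χ : DirichletCharacter ℂ m) :
    IsIntegral ℤ (gaussSum χ (ZMod.stdAddChar (N := m))) := by
  unfold gaussSum
  exact IsIntegral.sum _ fun a _ => (isIntegral_dirichletCharacter_apply χ a).mul (isIntegral_stdAddChar a)

/-! ## §2 The depletion index set and the Euler-factor bookkeeping -/

section Depletion

variable {N : ℕ} [NeZero N] {m : ℕ} [NeZero m] {p : ℕ}

/-- For `p ∣ N` and `m` coprime to `pN`: the primes of `m·(p·N)` not dividing `m` are exactly the primes of `N`.
[folklore] -/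
theorem primeFactors_filter_not_dvd_eq (hp : p.Prime) (hpN : p ∣ N) (hm : m.Coprime (p * N)) :
    (m * (p * N)).primeFactors.filter (fun q => ¬ q ∣ m) = N.primeFactors := by
  have hN0 : N ≠ 0 := NeZero.ne N
  have hm0 : m ≠ 0 := NeZero.ne m
  have hp0 : p ≠ 0 := hp.ne_zero
  ext q
  simp only [Finset.mem_filter, Nat.mem_primeFactors, ne_eq, mul_eq_zero, hm0, hp0, hN0, or_self,
    not_false_eq_true, and_true]
  constructor
  · rintro ⟨⟨hq, hdvd⟩, hqm⟩
    refine ⟨hq, ?_⟩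
    rcases (Nat.Prime.dvd_mul hq).mp hdvd with h | h
    · exact absurd h hqm
    · rcases (Nat.Prime.dvd_mul hq).mp h with h' | h'
      · exact (Nat.prime_dvd_prime_iff_eq hq hp).mp h' ▸ hpN
      · exact h'
  · rintro ⟨hq, hqN⟩
    refine ⟨⟨hq, dvd_mul_of_dvd_right (dvd_mul_of_dvd_right hqN p) m⟩, fun hqm => ?_⟩
    have h1 : q ∣ Nat.gcd m (p * N) := Nat.dvd_gcd hqm (dvd_mul_of_dvd_right hqN p)
    rw [hm] at h1
    exact hq.one_lt.ne' (Nat.dvd_one.mp h1)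

variable (V : WeierstrassCurve ℚ) [V.IsElliptic] {f : CuspForm (Gamma0 N) 2}

omit [V.IsElliptic] in
/-- **The depletion identity at `s = 1`, additive-aware form.** For the newform `f` of `V` at level `N`, `p ∣ N`,
`a_ℓ(V) = 0` whenever `ℓ² ∣ N` (in particular at the additive prime `p`), `m` coprime to `pN`, and `χ` mod `m`:
if `L` continues the `(m·pN)`-inflated `χ`-series (`IsDepletedTwistedL f m (p*N) χ L`) and `L₀` the `χ`-series,
then `L 1 = ∏_{ℓ ∈ N.primeFactors, ℓ² ∤ N} (1 − χ(ℓ) a_ℓ ℓ⁻¹) · L₀ 1`. [cite: Kato2004Asterisque, §6.2 (p. 161)] -/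
theorem depleted_one_eq_prod_mul [Fact p.Prime] (hf : IsNewformOf V f) (hpN : p ∣ N)
    (hsq : ∀ q ∈ N.primeFactors, q ^ 2 ∣ N → V.LFunction q = 0) (hm : m.Coprime (p * N))
    (χ : DirichletCharacter ℂ m) {L L₀ : ℂ → ℂ} (hL : EulerSystemValues.IsDepletedTwistedL f m (p * N) χ L)
    (hL₀ : Differentiable ℂ L₀) (hL₀s : ∀ s : ℂ, 2 < s.re → L₀ s = twistedLSeries f χ s) :
    L 1 = (∏ q ∈ N.primeFactors.filter (fun q => ¬ q ^ 2 ∣ N),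
        (1 - χ (q : ZMod m) * (V.LFunction q : ℂ) * (q : ℂ)⁻¹)) * L₀ 1 := by
  rw [depletedTwistedL_one_eq hf.1 χ hL hL₀ hL₀s, primeFactors_filter_not_dvd_eq Fact.out hpN hm]
  congr 1
  rw [← Finset.prod_filter_mul_prod_filter_not N.primeFactors (fun q => ¬ q ^ 2 ∣ N)]
  have h1 : ∏ q ∈ N.primeFactors.filter (fun q => ¬ ¬ q ^ 2 ∣ N),
      (1 - χ (q : ZMod m) * cuspCoeff f q * (q : ℂ) ^ (-(1 : ℂ)) +
        (if q ∣ N then 0 else (q : ℂ)) * χ (q : ZMod m) ^ 2 * ((q : ℂ) ^ (-(1 : ℂ))) ^ 2) = 1 := by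
    refine Finset.prod_eq_one fun q hq => ?_
    obtain ⟨hqN, hsq'⟩ := Finset.mem_filter.mp hq
    have hqN' : q ∣ N := Nat.dvd_of_mem_primeFactors hqN
    have ha : cuspCoeff f q = 0 := by
      rw [hf.2 q, hsq q hqN (not_not.mp hsq'), Int.cast_zero]
    simp [ha, hqN']
  rw [h1, mul_one]
  refine Finset.prod_congr rfl fun q hq => ?_
  obtain ⟨hqN, -⟩ := Finset.mem_filter.mp hq
  have hqN' : q ∣ N := Nat.dvd_of_mem_primeFactors hqN
  have hq0 : (q : ℂ) ≠ 0 := by exact_mod_cast (Nat.prime_of_mem_primeFactors hqN).ne_zero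
  rw [if_pos hqN', zero_mul, zero_mul, add_zero, hf.2 q, Complex.cpow_neg_one]

omit [NeZero N] [NeZero m] [V.IsElliptic] in
/-- **Euler-factor bookkeeping**: `∏_{ℓ∥N}(ℓ − a_ℓχ(ℓ))(ℓ − a_ℓχ(ℓ)⁻¹) = [∏(ℓ − a_ℓχ(ℓ))]·[∏ ℓ]·∏(1 − χ⁻¹(ℓ)a_ℓ ℓ⁻¹)`.
[folklore] -/
theorem prod_euler_eq (χ : DirichletCharacter ℂ m) :
    (∏ q ∈ N.primeFactors.filter (fun q => ¬ q ^ 2 ∣ N),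
        (((q : ℂ) - (V.LFunction q : ℂ) * χ (q : ZMod m)) * ((q : ℂ) - (V.LFunction q : ℂ) * (χ (q : ZMod m))⁻¹))) =
      (∏ q ∈ N.primeFactors.filter (fun q => ¬ q ^ 2 ∣ N), ((q : ℂ) - (V.LFunction q : ℂ) * χ (q : ZMod m))) *
        (∏ q ∈ N.primeFactors.filter (fun q => ¬ q ^ 2 ∣ N), (q : ℂ)) *
        ∏ q ∈ N.primeFactors.filter (fun q => ¬ q ^ 2 ∣ N),
          (1 - χ⁻¹ (q : ZMod m) * (V.LFunction q : ℂ) * (q : ℂ)⁻¹) := by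
  rw [mul_assoc, ← Finset.prod_mul_distrib, ← Finset.prod_mul_distrib]
  refine Finset.prod_congr rfl fun q hq => ?_
  obtain ⟨hqN, -⟩ := Finset.mem_filter.mp hq
  have hq0 : (q : ℂ) ≠ 0 := by exact_mod_cast (Nat.prime_of_mem_primeFactors hqN).ne_zero
  rw [MulChar.inv_apply_eq_inv']
  field_simp

end Depletion

/-! ## §3 The value exit: depleted Néron integrality ⟹ F″'s conclusion for `(ϖ, r)` -/

section Exit

variable {N : ℕ} [NeZero N] {m : ℕ} [NeZero m] {p : ℕ} [Fact p.Prime]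
  (V : WeierstrassCurve ℚ) [V.IsElliptic] {f : CuspForm (Gamma0 N) 2}

/-- ★ **Value exit, EVEN characters.** `f` the newform of `V` at level `N`, `p ∣ N` with `a_ℓ(V) = 0` at every
`ℓ² ∣ N` (e.g. `N` the conductor: additive primes), `m` coprime to `pN`, `χ` primitive mod `m` and even; `ϖ ∈ ℚ`,
`r ∈ ℂ` with `ϖ·Ω⁺(V) = Ω⁺_f` and `∏_{ℓ∥N}(ℓ − a_ℓχ(ℓ))(ℓ − a_ℓχ(ℓ)⁻¹)·Σ_aχ(a){∞,a/m}_f = r·Ω⁺_f` (F″'s binders).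
If the `(m·pN)`-DEPLETED critical value of `χ̄` is Néron-`p`-integral — `∃ s, p ∤ s, s·L(1)/Ω⁺(V) ∈ ℤ̄` for an
entire `L` with `IsDepletedTwistedL f m (p*N) χ⁻¹ L` — then `∃ s, p ∤ s, s·ϖ·r ∈ ℤ̄` (F″'s even clause). Identity:
`ϖ·r = [∏_{ℓ∥N} ℓ(ℓ − a_ℓχ(ℓ))]·τ(χ)·L(1)/Ω⁺(V)` (Birch + depletion).
[cite: MazurTateTeitelbaum1986, §I.8 (8.6)] [cite: Kato2004Asterisque, §6.2 (p. 161) and Thm. 6.6 (1) (p. 163)] -/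
theorem katoNeron_even_of_depletedValue (hf : IsNewformOf V f) (hpN : p ∣ N)
    (hsq : ∀ q ∈ N.primeFactors, q ^ 2 ∣ N → V.LFunction q = 0) (hm : m.Coprime (p * N))
    {χ : DirichletCharacter ℂ m} (hχ : χ.IsPrimitive) {ϖ : ℚ} {r : ℂ}
    {L : ℂ → ℂ} (hL : EulerSystemValues.IsDepletedTwistedL f m (p * N) χ⁻¹ L)
    (hint : ∃ s : ℕ, ¬ p ∣ s ∧ IsIntegral ℤ ((s : ℂ) * (L 1 / (V.realPeriodRat : ℂ))))
    (hϖ : (ϖ : ℝ) * V.realPeriodRat = plusPeriod f)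
    (hr : (∏ ℓ ∈ N.primeFactors with ¬ ℓ ^ 2 ∣ N,
        (((ℓ : ℂ) - (V.LFunction ℓ : ℂ) * χ (ℓ : ZMod m)) *
          ((ℓ : ℂ) - (V.LFunction ℓ : ℂ) * (χ (ℓ : ZMod m))⁻¹))) *
        twistedSymbolSum f χ = r * (plusPeriod f : ℂ)) :
    ∃ s : ℕ, ¬ p ∣ s ∧ IsIntegral ℤ ((s : ℂ) * ϖ * r) := by
  obtain ⟨s, hps, hsint⟩ := hint
  refine ⟨s, hps, ?_⟩
  -- Birch for `χ̄` and the depletion identity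
  obtain ⟨L₀, hL₀d, hL₀s⟩ := exists_differentiable_eq_twistedLSeries_holds f χ⁻¹
  have hBirch : gaussSum χ (ZMod.stdAddChar (N := m)) * L₀ 1 = twistedSymbolSum f χ := by
    have h := twisted_LValue_eq_holds f (m := m) (isPrimitive_inv hχ) hL₀d hL₀s
    rwa [inv_inv] at h
  have hdepl := depleted_one_eq_prod_mul V hf hpN hsq hm χ⁻¹ hL hL₀d hL₀s
  -- the algebraic-integer bracket
  set A : ℂ := ∏ q ∈ N.primeFactors.filter (fun q => ¬ q ^ 2 ∣ N),
    ((q : ℂ) - (V.LFunction q : ℂ) * χ (q : ZMod m)) with hA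
  set Q : ℂ := ∏ q ∈ N.primeFactors.filter (fun q => ¬ q ^ 2 ∣ N), (q : ℂ) with hQ
  set E : ℂ := ∏ q ∈ N.primeFactors.filter (fun q => ¬ q ^ 2 ∣ N),
    (1 - χ⁻¹ (q : ZMod m) * (V.LFunction q : ℂ) * (q : ℂ)⁻¹) with hE
  have hPROD := prod_euler_eq (N := N) V χ
  rw [← hA, ← hQ, ← hE] at hPROD
  have hzint : ∀ z : ℤ, IsIntegral ℤ (z : ℂ) := fun z => by
    have h := isIntegral_algebraMap (R := ℤ) (A := ℂ) (x := z)
    simpa using h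
  have hnint : ∀ n : ℕ, IsIntegral ℤ (n : ℂ) := fun n => by
    have h := isIntegral_algebraMap (R := ℤ) (A := ℂ) (x := (n : ℤ))
    simpa using h
  have hAint : IsIntegral ℤ A := by
    refine IsIntegral.prod _ fun q _ => ?_
    exact (hnint q).sub ((hzint _).mul (isIntegral_dirichletCharacter_apply χ _))
  have hQint : IsIntegral ℤ Q := IsIntegral.prod _ fun q _ => hnint q
  have hτint := isIntegral_gaussSum χ
  -- the identity `s ϖ r = A Q τ · (s L(1)/Ω⁺(V))`
  have hΩ0 : (V.realPeriodRat : ℂ) ≠ 0 := by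
    exact_mod_cast (V.realPeriodRat_pos_holds : 0 < V.realPeriodRat).ne'
  by_cases hϖ0 : ϖ = 0
  · rw [hϖ0, Rat.cast_zero, mul_zero, zero_mul]; exact isIntegral_zero
  have hΩf : (plusPeriod f : ℂ) = (ϖ : ℂ) * (V.realPeriodRat : ℂ) := by
    rw [← hϖ, Complex.ofReal_mul, Complex.ofReal_ratCast]
  have key : (s : ℂ) * ϖ * r = A * Q * gaussSum χ (ZMod.stdAddChar (N := m)) *
      ((s : ℂ) * (L 1 / (V.realPeriodRat : ℂ))) := by
    have hϖc : (ϖ : ℂ) ≠ 0 := by exact_mod_cast hϖ0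
    have hr' : r * ((ϖ : ℂ) * (V.realPeriodRat : ℂ)) = A * Q * E * (gaussSum χ (ZMod.stdAddChar (N := m)) * L₀ 1) := by
      rw [← hΩf, ← hr, hPROD, hBirch]
    rw [hdepl]
    field_simp
    linear_combination (s : ℂ) * hr'
  rw [key]
  exact ((hAint.mul hQint).mul hτint).mul hsint

/-- ★ **Value exit, ODD characters.** Same with `ϖ·Ω⁻(V) = Ω⁻_f` (`Ω⁻(V) = V.imaginaryPeriodRat`), the defining
identity `∏…·Σ_aχ(a){∞,a/m}_f = r·Ω⁻_f·i`, and the depleted value normalised by `i·Ω⁻(V)`: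
`∃ s, p ∤ s, s·L(1)/(i·Ω⁻(V)) ∈ ℤ̄` ⟹ `∃ s, p ∤ s, s·ϖ·r ∈ ℤ̄` (F″'s odd clause).
[cite: MazurTateTeitelbaum1986, §I.8 (8.6)] [cite: Kato2004Asterisque, §6.2 (p. 161) and Thm. 6.6 (1) (p. 163)] -/
theorem katoNeron_odd_of_depletedValue (hf : IsNewformOf V f) (hpN : p ∣ N)
    (hsq : ∀ q ∈ N.primeFactors, q ^ 2 ∣ N → V.LFunction q = 0) (hm : m.Coprime (p * N))
    {χ : DirichletCharacter ℂ m} (hχ : χ.IsPrimitive) {ϖ : ℚ} {r : ℂ}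
    {L : ℂ → ℂ} (hL : EulerSystemValues.IsDepletedTwistedL f m (p * N) χ⁻¹ L)
    (hint : ∃ s : ℕ, ¬ p ∣ s ∧ IsIntegral ℤ ((s : ℂ) * (L 1 / (Complex.I * (V.imaginaryPeriodRat : ℂ)))))
    (hϖ : (ϖ : ℝ) * V.imaginaryPeriodRat = minusPeriod f)
    (hr : (∏ ℓ ∈ N.primeFactors with ¬ ℓ ^ 2 ∣ N,
        (((ℓ : ℂ) - (V.LFunction ℓ : ℂ) * χ (ℓ : ZMod m)) *
          ((ℓ : ℂ) - (V.LFunction ℓ : ℂ) * (χ (ℓ : ZMod m))⁻¹))) *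
        twistedSymbolSum f χ = r * (minusPeriod f : ℂ) * Complex.I) :
    ∃ s : ℕ, ¬ p ∣ s ∧ IsIntegral ℤ ((s : ℂ) * ϖ * r) := by
  obtain ⟨s, hps, hsint⟩ := hint
  refine ⟨s, hps, ?_⟩
  obtain ⟨L₀, hL₀d, hL₀s⟩ := exists_differentiable_eq_twistedLSeries_holds f χ⁻¹
  have hBirch : gaussSum χ (ZMod.stdAddChar (N := m)) * L₀ 1 = twistedSymbolSum f χ := by
    have h := twisted_LValue_eq_holds f (m := m) (isPrimitive_inv hχ) hL₀d hL₀s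
    rwa [inv_inv] at h
  have hdepl := depleted_one_eq_prod_mul V hf hpN hsq hm χ⁻¹ hL hL₀d hL₀s
  set A : ℂ := ∏ q ∈ N.primeFactors.filter (fun q => ¬ q ^ 2 ∣ N),
    ((q : ℂ) - (V.LFunction q : ℂ) * χ (q : ZMod m)) with hA
  set Q : ℂ := ∏ q ∈ N.primeFactors.filter (fun q => ¬ q ^ 2 ∣ N), (q : ℂ) with hQ
  set E : ℂ := ∏ q ∈ N.primeFactors.filter (fun q => ¬ q ^ 2 ∣ N),
    (1 - χ⁻¹ (q : ZMod m) * (V.LFunction q : ℂ) * (q : ℂ)⁻¹) with hE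
  have hPROD := prod_euler_eq (N := N) V χ
  rw [← hA, ← hQ, ← hE] at hPROD
  have hzint : ∀ z : ℤ, IsIntegral ℤ (z : ℂ) := fun z => by
    have h := isIntegral_algebraMap (R := ℤ) (A := ℂ) (x := z)
    simpa using h
  have hnint : ∀ n : ℕ, IsIntegral ℤ (n : ℂ) := fun n => by
    have h := isIntegral_algebraMap (R := ℤ) (A := ℂ) (x := (n : ℤ))
    simpa using h
  have hAint : IsIntegral ℤ A := by
    refine IsIntegral.prod _ fun q _ => ?_
    exact (hnint q).sub ((hzint _).mul (isIntegral_dirichletCharacter_apply χ _))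
  have hQint : IsIntegral ℤ Q := IsIntegral.prod _ fun q _ => hnint q
  have hτint := isIntegral_gaussSum χ
  have hΩ0 : (V.imaginaryPeriodRat : ℂ) ≠ 0 := by
    exact_mod_cast (V.imaginaryPeriodRat_pos).ne'
  by_cases hϖ0 : ϖ = 0
  · rw [hϖ0, Rat.cast_zero, mul_zero, zero_mul]; exact isIntegral_zero
  have hΩf : (minusPeriod f : ℂ) = (ϖ : ℂ) * (V.imaginaryPeriodRat : ℂ) := by
    rw [← hϖ, Complex.ofReal_mul, Complex.ofReal_ratCast]
  have key : (s : ℂ) * ϖ * r = A * Q * gaussSum χ (ZMod.stdAddChar (N := m)) *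
      ((s : ℂ) * (L 1 / (Complex.I * (V.imaginaryPeriodRat : ℂ)))) := by
    have hϖc : (ϖ : ℂ) ≠ 0 := by exact_mod_cast hϖ0
    have hr' : r * ((ϖ : ℂ) * (V.imaginaryPeriodRat : ℂ)) * Complex.I =
        A * Q * E * (gaussSum χ (ZMod.stdAddChar (N := m)) * L₀ 1) := by
      rw [← hΩf, ← hr, hPROD, hBirch]
    rw [hdepl]
    field_simp
    linear_combination (s : ℂ) * hr'
  rw [key]
  exact ((hAint.mul hQint).mul hτint).mul hsint

end Exit

end Summit.BirchSwinnertonDyer.BirchSwinnertonDyer.Theorems.StarredOptimalManinUnitFiveSevenValueExit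

end
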